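import Summits.ResolutionOfSingularities.ResolutionOfSingularities.Theorems.FrobeniusClosingPatchingRelPerfectDepthPhaseCLocalGameSuffices
import Summits.ResolutionOfSingularities.ResolutionOfSingularities.Theorems.FrobeniusClosingPatchingRelPerfectDepthPhaseCOneAssembly
import HarnessLib

/-!
# Crux `PatchingRelPerfect` (stmt-ResolutionOfSingularities-16161), chain W5.2 — F7(β) (β-AX) C-I: (G-A) PLUGGED INTO THE (A) INTERFACE —
# `PhaseCOne CylReach` from marked order reduction (G-T) and the pole cures

[OURS · L1 W5.2 · F7(β) (β-AX) X3 C-I (res-L1-w52-plan-1 g12 RULING G12-39 (A) interface `ChainW52F7BetaRP.phaseCOne_cylReach_of_stages (Good)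
(hLMG) (hCure)` of res-L1-w52-lead-1, with `Good K := ∃ 𝓛, ∀ x ∈ cosupp K, IsEndNear K 𝓛 x` the instance of record, G12-27 (A); RULING G12-41
(4) (G-A))] Fact-free; def-free; bodies unfolded (`IsEndNear`, `EndOrderReduction`); NOT statements of the manuscript under review (Hironaka 2017);
AI-written, weaker than expert review.

* `hLMG_of_orderReduction` — the `hLMG` argument of the (A) interface, for `Good K := ∃ 𝓛, ∀ x ∈ cosupp K, IsEndNear K 𝓛 x` (unfolded), from
  marked order reduction for every `m ≥ 1` (res-D-pv-054 (G-A) `X3LocalGame.endOrderReductionSuffices`; integrality, excellence and `K ≠ ⊥`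
  are not needed).
* `phaseCOne_cylReach_of_orderReduction` — **`PhaseCOne CylReach` from (G-T) `∀ m ≥ 1, EndOrderReduction m` and the pole cures `hCure`**
  (lead-1΄s assembly with stage 2 discharged by (G-A)).

## References
* J. Kollár, *Lectures on Resolution of Singularities* (2007), (3.111) Steps 1–3. [Kollar2007]
-/

-- `Summit.<Summit>.<Sub>.Theorems` with `Sub = Summit` (single-conjunct summit, D-0017)
set_option linter.dupNamespace false

noncomputable section

open CategoryTheory CategoryTheory.Limits AlgebraicGeometry TopologicalSpace IsLocalRing
open Literature.AlgebraicGeometry.Resolution Scheme.IdealSheafData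

namespace Summit.ResolutionOfSingularities.ResolutionOfSingularities.Theorems

universe u

namespace X3LocalGame

open DepthMultiHost ChainW52F7BetaRP

/-- [OURS · L1 W5.2 · C-I] **Stage 2 of the (A) interface from (G-T)**: marked order reduction for locally-END ideals, for every `m ≥ 1`,
gives the `hLMG` argument of `phaseCOne_cylReach_of_stages` for the «locally END» goodness predicate. [cite: Kollar2007, (3.111) Step 3] -/
theorem hLMG_of_orderReduction
    (hred : ∀ m : ℕ, 1 ≤ m → ∀ (X : Scheme.{u}) [IsNoetherian X], Scheme.IsRegular X →
      ∀ (K : X.IdealSheafData) (𝓛 : List X.IdealSheafData), 1 ≤ m →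
        (∀ x ∈ (K.support : Set X), ∃ Λ : List X.IdealSheafData, (∀ F ∈ Λ, F ∈ 𝓛) ∧
          ∃ U : X.Opens, x ∈ (U : Set X) ∧ HasSNC (Λ.map fun F => F.comap U.ι) ∧
            ∃ 𝒦 : List (List (X.IdealSheafData × ℕ)), (∀ L ∈ 𝒦, boundaryOf L = Λ) ∧ 𝒦 ≠ [] ∧
              K.comap U.ι = (DepthTargets.monomialSum 𝒦).comap U.ι) →
        (∀ x : X, idealOrder K x ≤ (m : ℕ∞)) →
          ∃ s : CentreSeq X, s.AllRegular ∧ s.CentresOver (⟨K, [], m⟩ : MarkedIdeal X).support ∧ Scheme.IsRegular s.top ∧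
            ∃ (_ : IsNoetherian s.top) (M K₁ : s.top.IdealSheafData) (𝓛₁ : List s.top.IdealSheafData),
              K.comap s.comp = M * K₁ ∧ IsEffectiveCartier M ∧
              (∀ x : s.top, idealOrder K₁ x < (m : ℕ∞)) ∧
              (∀ x ∈ (K₁.support : Set s.top), ∃ Λ : List s.top.IdealSheafData, (∀ F ∈ Λ, F ∈ 𝓛₁) ∧
                ∃ U : s.top.Opens, x ∈ (U : Set s.top) ∧ HasSNC (Λ.map fun F => F.comap U.ι) ∧
                  ∃ 𝒦 : List (List (s.top.IdealSheafData × ℕ)), (∀ L ∈ 𝒦, boundaryOf L = Λ) ∧ 𝒦 ≠ [] ∧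
                    K₁.comap U.ι = (DepthTargets.monomialSum 𝒦).comap U.ι) ∧
              (K₁.support : Set s.top) ⊆ s.comp ⁻¹' (K.support : Set X)) :
    ∀ (Y : Scheme.{u}) [IsNoetherian Y] [IsIntegral Y], Scheme.IsRegular Y → Scheme.IsExcellent Y →
      ∀ K : Y.IdealSheafData, K ≠ ⊥ →
        (∃ 𝓛 : List Y.IdealSheafData, ∀ x ∈ (K.support : Set Y), ∃ Λ : List Y.IdealSheafData, (∀ F ∈ Λ, F ∈ 𝓛) ∧
          ∃ U : Y.Opens, x ∈ (U : Set Y) ∧ HasSNC (Λ.map fun F => F.comap U.ι) ∧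
            ∃ 𝒦 : List (List (Y.IdealSheafData × ℕ)), (∀ L ∈ 𝒦, boundaryOf L = Λ) ∧ 𝒦 ≠ [] ∧
              K.comap U.ι = (DepthTargets.monomialSum 𝒦).comap U.ι) →
        ∃ s : CentreSeq Y, s.AllRegular ∧ s.CentresOver (K.support : Set Y) ∧ Scheme.IsRegular s.top ∧
          IsLocallyPrincipal (K.comap s.comp) := by
  intro Y _ _ hY _ K _ hgood
  obtain ⟨𝓛, h𝓛⟩ := hgood
  exact endOrderReductionSuffices hred Y hY K 𝓛 h𝓛

/-- [OURS · L1 W5.2 · C-I] **`PhaseCOne CylReach` FROM (G-T) AND THE POLE CURES**: res-L1-w52-lead-1΄s (A) interface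
`phaseCOne_cylReach_of_stages` with `Good K := ∃ 𝓛, ∀ x ∈ cosupp K, IsEndNear K 𝓛 x` (unfolded), its stage 2 (`hLMG`) discharged by marked
order reduction (G-T) through (G-A); open content = `hred` ((G-T), all `m ≥ 1`) + `hCure` (the pole cures delivering local END of `K♭𝒪`
after a regular-centre tower over `cosupp K♭`). [cite: Kollar2007, (3.111) Steps 1–3] -/
theorem phaseCOne_cylReach_of_orderReduction
    (hred : ∀ m : ℕ, 1 ≤ m → ∀ (X : Scheme.{u}) [IsNoetherian X], Scheme.IsRegular X →
      ∀ (K : X.IdealSheafData) (𝓛 : List X.IdealSheafData), 1 ≤ m →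
        (∀ x ∈ (K.support : Set X), ∃ Λ : List X.IdealSheafData, (∀ F ∈ Λ, F ∈ 𝓛) ∧
          ∃ U : X.Opens, x ∈ (U : Set X) ∧ HasSNC (Λ.map fun F => F.comap U.ι) ∧
            ∃ 𝒦 : List (List (X.IdealSheafData × ℕ)), (∀ L ∈ 𝒦, boundaryOf L = Λ) ∧ 𝒦 ≠ [] ∧
              K.comap U.ι = (DepthTargets.monomialSum 𝒦).comap U.ι) →
        (∀ x : X, idealOrder K x ≤ (m : ℕ∞)) →
          ∃ s : CentreSeq X, s.AllRegular ∧ s.CentresOver (⟨K, [], m⟩ : MarkedIdeal X).support ∧ Scheme.IsRegular s.top ∧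
            ∃ (_ : IsNoetherian s.top) (M K₁ : s.top.IdealSheafData) (𝓛₁ : List s.top.IdealSheafData),
              K.comap s.comp = M * K₁ ∧ IsEffectiveCartier M ∧
              (∀ x : s.top, idealOrder K₁ x < (m : ℕ∞)) ∧
              (∀ x ∈ (K₁.support : Set s.top), ∃ Λ : List s.top.IdealSheafData, (∀ F ∈ Λ, F ∈ 𝓛₁) ∧
                ∃ U : s.top.Opens, x ∈ (U : Set s.top) ∧ HasSNC (Λ.map fun F => F.comap U.ι) ∧
                  ∃ 𝒦 : List (List (s.top.IdealSheafData × ℕ)), (∀ L ∈ 𝒦, boundaryOf L = Λ) ∧ 𝒦 ≠ [] ∧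
                    K₁.comap U.ι = (DepthTargets.monomialSum 𝒦).comap U.ι) ∧
              (K₁.support : Set s.top) ⊆ s.comp ⁻¹' (K.support : Set X))
    (hCure : ∀ {X : Scheme.{u}} [IsNoetherian X], Scheme.IsRegular X → Scheme.IsExcellent X →
      ∀ (S : MultiHostState X) (cyl : CylState S) [IsIntegral cyl.Z] [IsNoetherian cyl.Z], Scheme.IsRegular cyl.Z → S.n ≠ 0 →
      ∀ (𝓒 : List X.IdealSheafData) (𝓗 : Fin S.n → List (X.IdealSheafData × ℕ)), S.IsFormatSncOn cyl.V 𝓒 𝓗 → CylReach S cyl →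
      ∃ c : CentreSeq X, c.AllRegular ∧ c.CentresOver (S.residual.K.support : Set X) ∧ Scheme.IsRegular c.top ∧
        ∃ _ : IsNoetherian c.top, ∃ 𝓛 : List c.top.IdealSheafData, ∀ x ∈ ((S.residual.K.comap c.comp).support : Set c.top),
          ∃ Λ : List c.top.IdealSheafData, (∀ F ∈ Λ, F ∈ 𝓛) ∧
            ∃ U : c.top.Opens, x ∈ (U : Set c.top) ∧ HasSNC (Λ.map fun F => F.comap U.ι) ∧
              ∃ 𝒦 : List (List (c.top.IdealSheafData × ℕ)), (∀ L ∈ 𝒦, boundaryOf L = Λ) ∧ 𝒦 ≠ [] ∧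
                (S.residual.K.comap c.comp).comap U.ι = (DepthTargets.monomialSum 𝒦).comap U.ι) :
    PhaseCOne CylReach.{u} :=
  phaseCOne_cylReach_of_stages
    (fun ⦃Y : Scheme.{u}⦄ (K : Y.IdealSheafData) => ∃ 𝓛 : List Y.IdealSheafData, ∀ x ∈ (K.support : Set Y),
      ∃ Λ : List Y.IdealSheafData, (∀ F ∈ Λ, F ∈ 𝓛) ∧
        ∃ U : Y.Opens, x ∈ (U : Set Y) ∧ HasSNC (Λ.map fun F : Y.IdealSheafData => F.comap U.ι) ∧
          ∃ 𝒦 : List (List (Y.IdealSheafData × ℕ)), (∀ L ∈ 𝒦, boundaryOf L = Λ) ∧ 𝒦 ≠ [] ∧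
            K.comap U.ι = (DepthTargets.monomialSum 𝒦).comap U.ι)
    (hLMG_of_orderReduction hred) hCure

end X3LocalGame

end Summit.ResolutionOfSingularities.ResolutionOfSingularities.Theorems

end
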